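/-
Copyright (c) 2026 the pub-hodgecm-mathlib formalisation cell (harness21).  Prover seat hodgecm-mathlib-K2E5-p16 (g5): Track B «K2-LIT»,
hLiu418 = stmt-HodgeConjecture-24832, ROAD Φ organ (SD-2), file (7c′): ★ (7b)∕(7c)∕(7d) made QUANTITATIVE IN THE DIRECTION `Ξ` — explicit
domination radius, growth constants uniform in `Ξ`, Cauchy factor polynomial in `Σ‖Ξ_{jk}‖` (junction interface census 2026-09-04T10:1xZ).
-/
import Summits.HodgeConjecture.HodgeConjecture.Theorems.K2LiuHermTwoXiShiftCauchyDerivatives   -- ★ (7d) (+ (7b), (7c))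
import HarnessLib

/-!
# Crux `HLiu418`, ROAD Φ, organ (SD-2) — file (7c′): growth of the `t`-derivatives of `xiShift (g₀ + tΞ) h α β` at `t = 0`, UNIFORM IN `Ξ`

Cell `hodgecm-mathlib`, crux item hLiu418 = `stmt-HodgeConjecture-24832`, route of record `HCCMUnconditional`; squad K2, LEAD F0P6-plan (g13)
(M-157s: the g-transfer direction `Ξ = h^{−1∕2} Θ h^{−1∕2}` depends on `h`), prover K2E5-p16 (g5).  THEOREMS ONLY; lane
`--supports stmt-HodgeConjecture-24832 --as helper`.

WHY.  In the junction `K2LiuKFiniteSectionWhittakerHolomorphyGrowth` the `g`-line directions `Ξ_j` of K2Liu-p05 (g4)'s (V-4) letter depend on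
the Fourier index `h`; ★ (7b) hides the domination radius behind `∃ r` and ★ (7c) its constant behind `∃ C` (both depend on `Ξ`), so growth
«uniform over the lattice of `h`» needs the dependence on `Ξ` made explicit.  Here it is:
* §1 `dominating_of_radius_le` — ★ (7b)'s certificate for EVERY radius `r` with `r · (2S + 1) ≤ c₀`, `S = Σ_{jk} ‖Ξ_{jk}‖`,
  `c₀ = det g₀ ∕ tr g₀` (in the chart: `(d₁d₂ − |z|²)∕(d₁ + d₂)`), with the weight constant `4S∕c₀`.
* §2 `norm_xiShift_param_le₂_uniform` — ★ (7c)'s three-factor bound on the disc with `C, N, N′` depending on `(g₀, K, L)` ONLY, for every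
  `Ξ` and every certified radius `r` with `r‖Ξ₀₀‖ ≤ d₁` (automatic for the radius of §1).
* §3 `norm_iteratedDeriv_xiShift_param_le_uniform` — THE HEAD: `∃ C A N N′` (depending on `g₀ = hermTwo d`, `K`, `L` only) with, for ALL
  `Ξ`, `h > 0`, `α ∈ K`, `β ∈ L`, `n`:
  `‖(d∕dt)^n xiShift (g₀ + tΞ) h α β |₀‖ ≤ C · n! · (A (1 + S(Ξ)))^n · e^{−π re tr(h g₀)} (1 + tr h)^N (1 + det h^{−N′})`.
* §4 `differentiableOn_iteratedDeriv_xiShift_param'` — ★ (7d)'s head with the certificate hypotheses discharged (user-facing form).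
HONEST LABEL.  Count-neutral helper of the K2_Liu road; it pays no socket by itself: `HC_CM` is proved only modulo the 7 printed citations
(2 remaining named inputs: hLiu418 = `stmt-HodgeConjecture-24832`, h413 = `stmt-HodgeConjecture-24833`) until rung 0 closes.
-/

set_option autoImplicit false
-- the mandated namespace repeats the single-problem summit's segment (`HodgeConjecture.HodgeConjecture`)
set_option linter.dupNamespace false

noncomputable section

open Complex MeasureTheory Set
open scoped ComplexOrder ComplexConjugate

namespace Summit.HodgeConjecture.HodgeConjecture.Cruxes.HLiu418.K2LiuHermTwoXiShiftParamGrowthUniform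

open Summit.HodgeConjecture.HodgeConjecture.Cruxes.HLiu418.K2LiuHermTwoGammaDefs
open Summit.HodgeConjecture.HodgeConjecture.Cruxes.HLiu418.K2LiuHermTwoEtaDefs
open Summit.HodgeConjecture.HodgeConjecture.Cruxes.HLiu418.K2LiuHermTwoEtaConvergence
open Summit.HodgeConjecture.HodgeConjecture.Cruxes.HLiu418.K2LiuHermTwoEtaHolomorphy
open Summit.HodgeConjecture.HodgeConjecture.Cruxes.HLiu418.K2LiuHermTwoXiEtaIdentity
open Summit.HodgeConjecture.HodgeConjecture.Cruxes.HLiu418.K2LiuHermTwoEtaShiftDefs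
open Summit.HodgeConjecture.HodgeConjecture.Cruxes.HLiu418.K2LiuHermTwoXiBetaShift
open Summit.HodgeConjecture.HodgeConjecture.Cruxes.HLiu418.K2LiuHermTwoXiShiftGrowth
open Summit.HodgeConjecture.HodgeConjecture.Cruxes.HLiu418.K2LiuHermTwoEtaShiftDominated
open Summit.HodgeConjecture.HodgeConjecture.Cruxes.HLiu418.K2LiuHermTwoEtaShiftDominatedGrowth
open Summit.HodgeConjecture.HodgeConjecture.Cruxes.HLiu418.K2LiuHermTwoXiShiftParamHolomorphy
open Summit.HodgeConjecture.HodgeConjecture.Cruxes.HLiu418.K2LiuHermTwoXiShiftParamGrowth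
open Summit.HodgeConjecture.HodgeConjecture.Cruxes.HLiu418.K2LiuHermTwoXiShiftCauchyDerivatives

/-! ## §1 The domination certificate at an explicit radius -/

/-- **★ (7b)'s DOMINATION CERTIFICATE AT EVERY SMALL RADIUS**: for `G₀ = hermTwo d₀ > 0`, any `Ξ`, and any `r` with `r (2S + 1) ≤ c₀`
(`S = Σ_{jk}‖Ξ_{jk}‖`, `c₀ = (d₁d₂ − |z|²)∕(d₁ + d₂)`): for `‖t‖ ≤ r` and `x = hermTwo c > 0`, `‖e^{−tr(x(G₀+tΞ))}‖ ≤ ‖e^{−tr(x·G₀∕2)}‖`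
and `|tr(xΞ)|·‖e^{−tr(x(G₀+tΞ))}‖ ≤ (4S∕c₀)·‖e^{−tr(x·G₀∕4)}‖`. -/
theorem dominating_of_radius_le {d₀ : ℝ × ℂ × ℝ} (hd₀ : 0 < d₀.1 ∧ normSq d₀.2.1 < d₀.1 * d₀.2.2) (Ξ : Matrix (Fin 2) (Fin 2) ℂ) {r : ℝ}
    (hr : r * (2 * (‖Ξ 0 0‖ + ‖Ξ 1 0‖ + ‖Ξ 0 1‖ + ‖Ξ 1 1‖) + 1) ≤ (d₀.1 * d₀.2.2 - normSq d₀.2.1) / (d₀.1 + d₀.2.2)) :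
    ∀ t : ℂ, ‖t‖ ≤ r → ∀ c : ℝ × ℂ × ℝ, (0 < c.1 ∧ normSq c.2.1 < c.1 * c.2.2) →
      ‖cexp (-(hermTwo c * (hermTwo d₀ + t • Ξ)).trace)‖ ≤ ‖cexp (-(hermTwo c * hermTwo ((1 / 2 : ℝ) • d₀)).trace)‖ ∧
      ‖(hermTwo c * Ξ).trace‖ * ‖cexp (-(hermTwo c * (hermTwo d₀ + t • Ξ)).trace)‖ ≤
        4 * (‖Ξ 0 0‖ + ‖Ξ 1 0‖ + ‖Ξ 0 1‖ + ‖Ξ 1 1‖) / ((d₀.1 * d₀.2.2 - normSq d₀.2.1) / (d₀.1 + d₀.2.2)) *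
          ‖cexp (-(hermTwo c * hermTwo ((1 / 4 : ℝ) • d₀)).trace)‖ := by
  have hq : 0 < d₀.2.2 := snd_pos_of_cone hd₀.1 hd₀.2
  set c₀ : ℝ := (d₀.1 * d₀.2.2 - normSq d₀.2.1) / (d₀.1 + d₀.2.2) with hc₀
  have hc₀pos : 0 < c₀ := div_pos (by linarith [hd₀.2]) (by linarith [hd₀.1])
  set S : ℝ := ‖Ξ 0 0‖ + ‖Ξ 1 0‖ + ‖Ξ 0 1‖ + ‖Ξ 1 1‖ with hS
  have hS0 : 0 ≤ S := by positivity
  intro t ht c hc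
  have hb : 0 < c.2.2 := snd_pos_of_cone hc.1 hc.2
  -- the real trace `T = tr(x G₀) ≥ c₀ tr x`
  set T : ℝ := c.1 * d₀.1 + c.2.2 * d₀.2.2 + 2 * (c.2.1 * conj d₀.2.1).re with hT
  have hlow := trace_mul_lower_bound hc.1 hc.2 hd₀.1 hd₀.2
  have htr0 : 0 ≤ c.1 + c.2.2 := by linarith [hc.1]
  have hTge : c₀ * (c.1 + c.2.2) ≤ T := by
    rw [hc₀, hT, div_mul_eq_mul_div, div_le_iff₀ (by linarith [hd₀.1])]
    linarith
  have hT0 : 0 ≤ T := le_trans (mul_nonneg hc₀pos.le htr0) hTge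
  -- `|t·tr(xΞ)| ≤ T/2`
  have hΞ := norm_trace_hermTwo_mul_le hc Ξ
  have htS : ‖t‖ * S ≤ c₀ / 2 := by
    have h1 : ‖t‖ * S ≤ r * S := mul_le_mul_of_nonneg_right ht hS0
    nlinarith [mul_nonneg (le_trans (norm_nonneg t) ht) hS0]
  have hre : ‖t * (hermTwo c * Ξ).trace‖ ≤ T / 2 := by
    rw [norm_mul]
    calc ‖t‖ * ‖(hermTwo c * Ξ).trace‖ ≤ ‖t‖ * ((c.1 + c.2.2) * S) := mul_le_mul_of_nonneg_left hΞ (norm_nonneg _)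
      _ = (‖t‖ * S) * (c.1 + c.2.2) := by ring
      _ ≤ (c₀ / 2) * (c.1 + c.2.2) := mul_le_mul_of_nonneg_right htS htr0
      _ ≤ T / 2 := by linarith
  -- the norms of the three exponentials
  have hG : ‖cexp (-(hermTwo c * (hermTwo d₀ + t • Ξ)).trace)‖ ≤ Real.exp (-(T / 2)) := by
    rw [Complex.norm_exp, trace_mul_param, trace_hermTwo_mul_hermTwo]
    refine Real.exp_le_exp.mpr ?_
    have h1 : -(t * (hermTwo c * Ξ).trace).re ≤ T / 2 := le_trans (neg_le_abs _) ((Complex.abs_re_le_norm _).trans hre)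
    simp only [neg_add_rev, add_re, neg_re, ofReal_re]
    linarith
  have hhalf : ‖cexp (-(hermTwo c * hermTwo ((1 / 2 : ℝ) • d₀)).trace)‖ = Real.exp (-(T / 2)) := by
    rw [Complex.norm_exp, trace_hermTwo_mul_hermTwo]
    congr 1
    simp only [Prod.smul_fst, Prod.smul_snd, smul_eq_mul, Complex.real_smul, neg_re, ofReal_re, hT, map_mul, Complex.conj_ofReal,
      Complex.mul_re, Complex.mul_im, Complex.ofReal_re, Complex.ofReal_im, zero_mul, sub_zero]
    ring
  have hquart : ‖cexp (-(hermTwo c * hermTwo ((1 / 4 : ℝ) • d₀)).trace)‖ = Real.exp (-(T / 4)) := by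
    rw [Complex.norm_exp, trace_hermTwo_mul_hermTwo]
    congr 1
    simp only [Prod.smul_fst, Prod.smul_snd, smul_eq_mul, Complex.real_smul, neg_re, ofReal_re, hT, map_mul, Complex.conj_ofReal,
      Complex.mul_re, Complex.mul_im, Complex.ofReal_re, Complex.ofReal_im, zero_mul, sub_zero]
    ring
  refine ⟨by rw [hhalf]; exact hG, ?_⟩
  rw [hquart]
  -- `|tr(xΞ)| e^{−T/2} ≤ S tr(x) e^{−T/2} ≤ (S/c₀) T e^{−T/2} ≤ (4S/c₀) e^{−T/4}`
  have hTe : T * Real.exp (-(T / 4)) ≤ 4 := by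
    have h1 : 1 + T / 4 ≤ Real.exp (T / 4) := by linarith [Real.add_one_le_exp (T / 4)]
    have h2 : Real.exp (-(T / 4)) * Real.exp (T / 4) = 1 := by rw [← Real.exp_add, neg_add_cancel, Real.exp_zero]
    nlinarith [Real.exp_pos (-(T / 4)), Real.exp_pos (T / 4)]
  calc ‖(hermTwo c * Ξ).trace‖ * ‖cexp (-(hermTwo c * (hermTwo d₀ + t • Ξ)).trace)‖
      ≤ ((c.1 + c.2.2) * S) * Real.exp (-(T / 2)) := mul_le_mul hΞ hG (norm_nonneg _) (by positivity)
    _ ≤ (T / c₀ * S) * Real.exp (-(T / 2)) := by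
        refine mul_le_mul_of_nonneg_right (mul_le_mul_of_nonneg_right ?_ hS0) (Real.exp_pos _).le
        rw [le_div_iff₀ hc₀pos]
        linarith
    _ = S / c₀ * (T * Real.exp (-(T / 4))) * Real.exp (-(T / 4)) := by
        rw [show -(T / 2) = -(T / 4) + -(T / 4) by ring, Real.exp_add]
        ring
    _ ≤ S / c₀ * 4 * Real.exp (-(T / 4)) :=
        mul_le_mul_of_nonneg_right (mul_le_mul_of_nonneg_left hTe (by positivity)) (Real.exp_pos _).le
    _ = 4 * S / c₀ * Real.exp (-(T / 4)) := by ring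

/-! ## Holomorphy of `t ↦ etaShift (G₀ + t•Ξ) H α β` -/


/-! ## §2 Growth on the disc with constants uniform in `Ξ` -/

/-- **★ (7c)'s THREE-FACTOR BOUND, UNIFORM IN THE DIRECTION**: for `g₀ = hermTwo d > 0` and compacts `K`, `L ⊆ {re β > 0}` there are
`C, N, N′ ≥ 0` (depending on `d, K, L` only) such that for EVERY `Ξ`, every `r ≥ 0` with `r‖Ξ₀₀‖ ≤ d₁` carrying ★ (7b)'s certificate for
`(2d, 2Ξ)`, every `‖t‖ ≤ r`, `h > 0`, `α ∈ K`, `β ∈ L`: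
`‖xiShift (g₀ + tΞ) h α β‖ ≤ C · e^{−π re tr(h g₀)} · (1 + tr h)^N · (1 + det h^{−N′})`. -/
theorem norm_xiShift_param_le₂_uniform {d : ℝ × ℂ × ℝ} (hd : 0 < d.1 ∧ normSq d.2.1 < d.1 * d.2.2)
    {K L : Set ℂ} (hK : IsCompact K) (hL : IsCompact L) (hL0 : ∀ β ∈ L, 0 < β.re) :
    ∃ C N N' : ℝ, 0 ≤ C ∧ 0 ≤ N ∧ 0 ≤ N' ∧ ∀ (Ξ : Matrix (Fin 2) (Fin 2) ℂ) (r : ℝ), 0 ≤ r → r * ‖Ξ 0 0‖ ≤ d.1 →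
      (∀ t : ℂ, ‖t‖ ≤ r → ∀ c : ℝ × ℂ × ℝ, (0 < c.1 ∧ normSq c.2.1 < c.1 * c.2.2) →
        ‖cexp (-(hermTwo c * (hermTwo ((2 : ℝ) • d) + t • ((2 : ℂ) • Ξ))).trace)‖ ≤ ‖cexp (-(hermTwo c * hermTwo ((1 / 2 : ℝ) • ((2 : ℝ) • d))).trace)‖) →
      ∀ t : ℂ, ‖t‖ ≤ r → ∀ h : Matrix (Fin 2) (Fin 2) ℂ, h.PosDef → ∀ α ∈ K, ∀ β ∈ L,
      ‖xiShift (hermTwo d + t • Ξ) h α β‖ ≤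
        C * Real.exp (-(Real.pi * ((h * hermTwo d).trace).re)) * (1 + ((h 0 0).re + (h 1 1).re)) ^ N *
          (1 + ((h 0 0).re * (h 1 1).re - normSq (h 0 1)) ^ (-N')) := by
  -- the boxes: `|re α| ≤ R`, `|α − 2| ≤ R + 2` on `K`; `b₁ ≤ re β ≤ b₂` on `L` with `b₁ > 0`
  obtain ⟨R₀, hR₀⟩ := hK.isBounded.subset_closedBall 0
  set R : ℝ := |R₀| with hR
  have hstrip : ∀ α ∈ K, -R ≤ α.re ∧ α.re ≤ R := fun α hα =>
    abs_le.mp (((Complex.abs_re_le_norm α).trans (mem_closedBall_zero_iff.mp (hR₀ hα))).trans (le_abs_self R₀))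
  have hM : ∀ α ∈ K, ‖α - 2‖ ≤ R + 2 := fun α hα =>
    (norm_sub_le _ _).trans (add_le_add (((mem_closedBall_zero_iff.mp (hR₀ hα))).trans (le_abs_self R₀)) (by simp))
  rcases L.eq_empty_or_nonempty with hLe | hLne
  · refine ⟨0, 0, 0, le_rfl, le_rfl, le_rfl, fun Ξ r _ _ _ t _ h _ α _ β hβ => ?_⟩
    rw [hLe] at hβ
    exact absurd hβ (Set.notMem_empty β)
  obtain ⟨βm, hβm, hβmin⟩ := (hL.image Complex.continuous_re).exists_isLeast (hLne.image _)
  obtain ⟨βM, hβM, hβmax⟩ := (hL.image Complex.continuous_re).exists_isGreatest (hLne.image _)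
  have hbox : ∀ β ∈ L, βm ≤ β.re ∧ β.re ≤ βM := fun β hβ =>
    ⟨hβmin (Set.mem_image_of_mem _ hβ), hβmax (Set.mem_image_of_mem _ hβ)⟩
  have hb₁0 : 0 < βm := by
    obtain ⟨β₁, hβ₁L, hβ₁eq⟩ := hβm
    rw [← hβ₁eq]
    exact hL0 β₁ hβ₁L
  have hb12 : βm ≤ βM := by
    obtain ⟨β₁, hβ₁L, hβ₁eq⟩ := hβm
    rw [← hβ₁eq]
    exact (hbox β₁ hβ₁L).2
  -- the prefactor is bounded on `K × L`
  obtain ⟨M, hMb⟩ := (hK.prod hL).exists_bound_of_continuousOn continuous_xiShiftPrefactor₂.continuousOn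
  -- the growth of the dominated `etaShift` at `(2(g₀ + tΞ), πh)`, dominating matrix `g₁ = g₀ = hermTwo d`
  have hg : (hermTwo d).PosDef := (posDef_hermTwo_iff d).mpr hd
  have hhalf : hermTwo ((1 / 2 : ℝ) • ((2 : ℝ) • d)) = hermTwo d := by rw [smul_smul]; norm_num
  have hR2 : 0 ≤ R + 2 := by positivity
  set M₀ : ℝ := 2 * ‖(d.1 : ℂ)‖ + 2 * d.1 with hM₀
  have hM₀0 : 0 ≤ M₀ := by have := hd.1; positivity
  obtain ⟨C, hC, hB⟩ := norm_etaShift_le₂_of_dominated hg (a₁ := -R) (a₂ := R) (by linarith [abs_nonneg R₀]) hb₁0 hb12 hR2 hM₀0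
  set N : ℝ := 2 * max (R - 2) 0 + 1 with hN
  set N' : ℝ := max (2 - -R) 0 + 1 with hN'
  have hN0 : 0 ≤ N := by positivity
  have hN'0 : 0 ≤ N' := by positivity
  refine ⟨max M 0 * (C * Real.pi ^ N), N, N', by positivity, hN0, hN'0, fun Ξ r hr hrΞ hcert t ht h hh α hα β hβ => ?_⟩
  obtain ⟨e, rfl⟩ : ∃ e : ℝ × ℂ × ℝ, hermTwo e = h := ⟨_, hermTwo_eq_of_isHermitian hh.1⟩
  have heh := (posDef_hermTwo_iff e).mp hh
  have he1 : 0 < e.1 := heh.1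
  have he2 : 0 < e.2.2 := snd_pos_of_cone heh.1 heh.2
  have hδ : 0 < e.1 * e.2.2 - normSq e.2.1 := by linarith [heh.2]
  have hπe : (hermTwo (Real.pi • e)).PosDef := posDef_hermTwo_smul Real.pi_pos hh
  -- domination of `G = 2(g₀ + tΞ)` by `g₀` on the domain of `η(·, πh)`
  have hdom : ∀ c ∈ etaTwoSet (hermTwo (Real.pi • e)),
      ‖cexp (-(hermTwo c * (hermTwo ((2 : ℝ) • d) + t • ((2 : ℂ) • Ξ))).trace)‖ ≤ ‖cexp (-(hermTwo c * hermTwo d).trace)‖ := by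
    intro c hc
    obtain ⟨-, hcm⟩ := (mem_etaTwoSet_iff _ c).mp hc
    have hx : (hermTwo c).PosDef := by
      have := hcm.add_posSemidef hπe.posSemidef
      rwa [sub_add_cancel] at this
    have h := hcert t ht c ((posDef_hermTwo_iff c).mp hx)
    rwa [hhalf] at h
  have hG00 : ‖(hermTwo ((2 : ℝ) • d) + t • ((2 : ℂ) • Ξ)) 0 0‖ ≤ M₀ := by
    rw [hM₀]
    have h1 : (hermTwo ((2 : ℝ) • d) + t • ((2 : ℂ) • Ξ)) 0 0 = 2 * (d.1 : ℂ) + t * ((2 : ℂ) • Ξ) 0 0 := by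
      simp [Matrix.add_apply, Matrix.smul_apply, hermTwo]
    rw [h1]
    refine (norm_add_le _ _).trans (add_le_add ?_ ?_)
    · rw [norm_mul]; norm_num
    · rw [norm_mul, Matrix.smul_apply, smul_eq_mul, norm_mul]
      calc ‖t‖ * (‖(2 : ℂ)‖ * ‖Ξ 0 0‖) ≤ r * (‖(2 : ℂ)‖ * ‖Ξ 0 0‖) := mul_le_mul_of_nonneg_right ht (by positivity)
        _ = 2 * (r * ‖Ξ 0 0‖) := by norm_num; ring
        _ ≤ 2 * d.1 := by linarith
  have hη := hB _ (hermTwo (Real.pi • e)) hπe hdom hG00 α β (hstrip α hα).1 (hstrip α hα).2 (hbox β hβ).1 (hbox β hβ).2 (hM α hα)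
  simp only [hermTwo_apply_zero_zero, hermTwo_apply_one_one, hermTwo_apply_zero_one, Prod.smul_fst, Prod.smul_snd, smul_eq_mul,
    Complex.real_smul, ofReal_re, trace_hermTwo_mul_hermTwo, map_mul, normSq_ofReal] at hη
  simp only [hermTwo_apply_zero_zero, hermTwo_apply_one_one, hermTwo_apply_zero_one, ofReal_re, trace_hermTwo_mul_hermTwo]
  rw [xiShift_def, two_smul_param, ← hermTwo_smul, norm_mul]
  have hT : Real.pi * e.1 * d.1 + Real.pi * e.2.2 * d.2.2 + 2 * ((Real.pi : ℂ) * e.2.1 * conj d.2.1).re =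
      Real.pi * (e.1 * d.1 + e.2.2 * d.2.2 + 2 * (e.2.1 * conj d.2.1).re) := by
    simp only [Complex.mul_re, Complex.mul_im, Complex.ofReal_re, Complex.ofReal_im]
    ring
  have hdet : Real.pi * e.1 * (Real.pi * e.2.2) - Real.pi * Real.pi * normSq e.2.1 = Real.pi ^ 2 * (e.1 * e.2.2 - normSq e.2.1) := by
    ring
  rw [hT, hdet] at hη
  have hπ3 := Real.pi_gt_three
  have htr : (1 + (Real.pi * e.1 + Real.pi * e.2.2)) ^ N ≤ Real.pi ^ N * (1 + (e.1 + e.2.2)) ^ N := by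
    rw [← Real.mul_rpow Real.pi_pos.le (by linarith [heh.1])]
    exact Real.rpow_le_rpow (by nlinarith [heh.1]) (by nlinarith [heh.1]) hN0
  have hdt : 1 + (Real.pi ^ 2 * (e.1 * e.2.2 - normSq e.2.1)) ^ (-N') ≤ 1 + (e.1 * e.2.2 - normSq e.2.1) ^ (-N') := by
    rw [Real.mul_rpow (by positivity) hδ.le]
    have h1 : (Real.pi ^ 2) ^ (-N') ≤ 1 := Real.rpow_le_one_of_one_le_of_nonpos (by nlinarith) (by linarith)
    nlinarith [Real.rpow_nonneg hδ.le (-N')]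
  have hP : 0 ≤ Real.pi ^ N * (1 + (e.1 + e.2.2)) ^ N := by positivity
  have hQ : 0 ≤ 1 + (Real.pi ^ 2 * (e.1 * e.2.2 - normSq e.2.1)) ^ (-N') := by
    linarith [Real.rpow_nonneg (show (0 : ℝ) ≤ Real.pi ^ 2 * (e.1 * e.2.2 - normSq e.2.1) by positivity) (-N')]
  have hη' := hη.trans (mul_le_mul_of_nonneg_left (mul_le_mul htr hdt hQ hP)
    (mul_nonneg hC (Real.exp_pos (-(Real.pi * (e.1 * d.1 + e.2.2 * d.2.2 + 2 * (e.2.1 * conj d.2.1).re)))).le))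
  have hpre : ‖((4 * Real.pi ^ 4 : ℝ) : ℂ) * cexp ((Real.pi * I) * (β - α)) * (hermTwoGamma α)⁻¹ * ((Real.pi : ℂ) * Complex.Gamma β ^ 2)⁻¹‖ ≤
      max M 0 :=
    (hMb (α, β) (Set.mk_mem_prod hα hβ)).trans (le_max_left _ _)
  calc ‖((4 * Real.pi ^ 4 : ℝ) : ℂ) * cexp ((Real.pi * I) * (β - α)) * (hermTwoGamma α)⁻¹ * ((Real.pi : ℂ) * Complex.Gamma β ^ 2)⁻¹‖ *
        ‖etaShift (hermTwo ((2 : ℝ) • d) + t • ((2 : ℂ) • Ξ)) (hermTwo (Real.pi • e)) α β‖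
      ≤ max M 0 * (C * Real.exp (-(Real.pi * (e.1 * d.1 + e.2.2 * d.2.2 + 2 * (e.2.1 * conj d.2.1).re))) *
          (Real.pi ^ N * (1 + (e.1 + e.2.2)) ^ N * (1 + (e.1 * e.2.2 - normSq e.2.1) ^ (-N')))) :=
        mul_le_mul hpre hη' (norm_nonneg _) (le_max_right _ _)
    _ = _ := by ring

/-! ## §3 The head: Cauchy bounds for the `t`-derivatives, uniform in `Ξ` -/

/-- `c₀(2d) = 2 det g₀ ∕ tr g₀ ≤ 2 d₁`. -/
theorem cone_ratio_two_smul_le {d : ℝ × ℂ × ℝ} (hd : 0 < d.1 ∧ normSq d.2.1 < d.1 * d.2.2) :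
    (((2 : ℝ) • d).1 * ((2 : ℝ) • d).2.2 - normSq ((2 : ℝ) • d).2.1) / (((2 : ℝ) • d).1 + ((2 : ℝ) • d).2.2) ≤ 2 * d.1 := by
  have hq : 0 < d.2.2 := snd_pos_of_cone hd.1 hd.2
  simp only [Prod.smul_fst, Prod.smul_snd, smul_eq_mul, Complex.real_smul, map_mul, normSq_ofReal]
  rw [div_le_iff₀ (by linarith [hd.1])]
  nlinarith [normSq_nonneg d.2.1, hd.1, hq]

/-- **GROWTH OF THE `t`-DERIVATIVES OF `xiShift (g₀ + tΞ) h α β` AT `t = 0`, UNIFORM IN `Ξ`** (the head of (7c′)): see the module docstring;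
`S(Ξ) = ‖Ξ₀₀‖ + ‖Ξ₁₀‖ + ‖Ξ₀₁‖ + ‖Ξ₁₁‖`. -/
theorem norm_iteratedDeriv_xiShift_param_le_uniform {d : ℝ × ℂ × ℝ} (hd : 0 < d.1 ∧ normSq d.2.1 < d.1 * d.2.2)
    {K L : Set ℂ} (hK : IsCompact K) (hL : IsCompact L) (hL0 : ∀ β ∈ L, 0 < β.re) :
    ∃ C A N N' : ℝ, 0 ≤ C ∧ 0 < A ∧ 0 ≤ N ∧ 0 ≤ N' ∧ ∀ (Ξ : Matrix (Fin 2) (Fin 2) ℂ) (h : Matrix (Fin 2) (Fin 2) ℂ), h.PosDef →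
      ∀ α ∈ K, ∀ β ∈ L, ∀ n : ℕ,
      ‖iteratedDeriv n (fun t : ℂ => xiShift (hermTwo d + t • Ξ) h α β) 0‖ ≤
        C * n.factorial * (A * (1 + (‖Ξ 0 0‖ + ‖Ξ 1 0‖ + ‖Ξ 0 1‖ + ‖Ξ 1 1‖))) ^ n *
          (Real.exp (-(Real.pi * ((h * hermTwo d).trace).re)) * (1 + ((h 0 0).re + (h 1 1).re)) ^ N *
            (1 + ((h 0 0).re * (h 1 1).re - normSq (h 0 1)) ^ (-N'))) := by
  obtain ⟨C, N, N', hC, hN, hN', hB⟩ := norm_xiShift_param_le₂_uniform hd hK hL hL0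
  have hd2 : 0 < ((2 : ℝ) • d).1 ∧ normSq ((2 : ℝ) • d).2.1 < ((2 : ℝ) • d).1 * ((2 : ℝ) • d).2.2 :=
    (posDef_hermTwo_iff _).mp (posDef_hermTwo_smul two_pos ((posDef_hermTwo_iff d).mpr hd))
  -- the cone ratio `c₀ = c₀(2d) > 0`
  set c₀ : ℝ := (((2 : ℝ) • d).1 * ((2 : ℝ) • d).2.2 - normSq ((2 : ℝ) • d).2.1) / (((2 : ℝ) • d).1 + ((2 : ℝ) • d).2.2) with hc₀
  have hc₀pos : 0 < c₀ := div_pos (by linarith [hd2.2]) (by linarith [hd2.1, snd_pos_of_cone hd2.1 hd2.2])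
  have hc₀le : c₀ ≤ 2 * d.1 := cone_ratio_two_smul_le hd
  refine ⟨C, 8 / c₀, N, N', hC, by positivity, hN, hN', fun Ξ h hh α hα β hβ n => ?_⟩
  -- the explicit radius `r = c₀ ∕ (2 S(2Ξ) + 1)`, `S(2Ξ) = 2 S(Ξ)`
  set S : ℝ := ‖Ξ 0 0‖ + ‖Ξ 1 0‖ + ‖Ξ 0 1‖ + ‖Ξ 1 1‖ with hS
  have hS0 : 0 ≤ S := by positivity
  have hS2 : ‖((2 : ℂ) • Ξ) 0 0‖ + ‖((2 : ℂ) • Ξ) 1 0‖ + ‖((2 : ℂ) • Ξ) 0 1‖ + ‖((2 : ℂ) • Ξ) 1 1‖ = 2 * S := by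
    simp only [Matrix.smul_apply, smul_eq_mul, norm_mul, hS]
    norm_num
    ring
  set r : ℝ := c₀ / (2 * (2 * S) + 1) with hr
  have hrpos : 0 < r := by positivity
  have hcert := dominating_of_radius_le hd2 ((2 : ℂ) • Ξ) (r := r) (by rw [hS2, hr, ← hc₀, div_mul_cancel₀ _ (by positivity)])
  have hrS : r * S ≤ c₀ / 4 := by
    rw [hr, div_mul_eq_mul_div, div_le_div_iff₀ (by positivity) (by norm_num)]
    nlinarith
  have hrΞ : r * ‖Ξ 0 0‖ ≤ d.1 := by
    have h1 : ‖Ξ 0 0‖ ≤ S := by rw [hS]; linarith [norm_nonneg (Ξ 1 0), norm_nonneg (Ξ 0 1), norm_nonneg (Ξ 1 1)]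
    nlinarith [mul_le_mul_of_nonneg_left h1 hrpos.le]
  -- `t`-holomorphy on the disc (★ (7b)) and the three-factor bound on the closed disc (§2)
  have hdiff : DifferentiableOn ℂ (fun t : ℂ => xiShift (hermTwo d + t • Ξ) h α β) (Metric.ball 0 r) := by
    have hη := differentiableOn_etaShift_param hd2 ((2 : ℂ) • Ξ) (posDef_pi_smul hh) hcert α (hL0 β hβ)
    have hf : (fun t : ℂ => xiShift (hermTwo d + t • Ξ) h α β) = fun t =>
        ((4 * Real.pi ^ 4 : ℝ) : ℂ) * cexp ((Real.pi * I) * (β - α)) * (hermTwoGamma α)⁻¹ * ((Real.pi : ℂ) * Complex.Gamma β ^ 2)⁻¹ *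
          etaShift (hermTwo ((2 : ℝ) • d) + t • ((2 : ℂ) • Ξ)) ((Real.pi : ℂ) • h) α β := by
      funext t
      rw [xiShift_def, two_smul_param]
    rw [hf]
    exact hη.const_mul _
  have hBt := hB Ξ r hrpos.le hrΞ (fun t ht c hc => (hcert t ht c hc).1)
  have hmain := norm_iteratedDeriv_xiShift_param_le (ρ := r / 2) (by positivity) (by linarith) hdiff
    (fun t ht => hBt t ht h hh α hα β hβ) n
  refine hmain.trans ?_
  -- `n! B ∕ (r∕2)^n ≤ C n! (A(1+S))^n · (three factors)`, `A = 8∕c₀`, since `2∕r = (8S+2)∕c₀ ≤ (8∕c₀)(1+S)`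
  have hB0 : 0 ≤ Real.exp (-(Real.pi * ((h * hermTwo d).trace).re)) * (1 + ((h 0 0).re + (h 1 1).re)) ^ N *
      (1 + ((h 0 0).re * (h 1 1).re - normSq (h 0 1)) ^ (-N')) := by
    obtain ⟨e, rfl⟩ : ∃ e : ℝ × ℂ × ℝ, hermTwo e = h := ⟨_, hermTwo_eq_of_isHermitian hh.1⟩
    have heh := (posDef_hermTwo_iff e).mp hh
    have hdet : 0 < (hermTwo e 0 0).re * (hermTwo e 1 1).re - normSq (hermTwo e 0 1) := by
      simp only [hermTwo_apply_zero_zero, hermTwo_apply_one_one, hermTwo_apply_zero_one, ofReal_re]; linarith [heh.2]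
    have htr : 0 < (hermTwo e 0 0).re + (hermTwo e 1 1).re := by
      simp only [hermTwo_apply_zero_zero, hermTwo_apply_one_one, ofReal_re]; linarith [heh.1, snd_pos_of_cone heh.1 heh.2]
    have := Real.rpow_nonneg hdet.le (-N')
    positivity
  have hρ : (1 : ℝ) / (r / 2) ^ n ≤ (8 / c₀ * (1 + S)) ^ n := by
    rw [one_div, ← inv_pow]
    refine pow_le_pow_left₀ (by positivity) ?_ n
    rw [hr, inv_le_iff_one_le_mul₀ (by positivity)]
    rw [show 8 / c₀ * (1 + S) * (c₀ / (2 * (2 * S) + 1) / 2) = (8 * (1 + S)) / (2 * (2 * (2 * S) + 1)) by field_simp]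
    rw [le_div_iff₀ (by positivity)]
    nlinarith
  calc (n.factorial : ℝ) * (C * Real.exp (-(Real.pi * ((h * hermTwo d).trace).re)) * (1 + ((h 0 0).re + (h 1 1).re)) ^ N *
          (1 + ((h 0 0).re * (h 1 1).re - normSq (h 0 1)) ^ (-N'))) / (r / 2) ^ n
      = C * n.factorial * (1 / (r / 2) ^ n) * (Real.exp (-(Real.pi * ((h * hermTwo d).trace).re)) *
          (1 + ((h 0 0).re + (h 1 1).re)) ^ N * (1 + ((h 0 0).re * (h 1 1).re - normSq (h 0 1)) ^ (-N'))) := by ring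
    _ ≤ C * n.factorial * (8 / c₀ * (1 + S)) ^ n * (Real.exp (-(Real.pi * ((h * hermTwo d).trace).re)) *
          (1 + ((h 0 0).re + (h 1 1).re)) ^ N * (1 + ((h 0 0).re * (h 1 1).re - normSq (h 0 1)) ^ (-N'))) :=
        mul_le_mul_of_nonneg_right (mul_le_mul_of_nonneg_left hρ (by positivity)) hB0

/-! ## §4 ★ (7d)'s head with the certificates discharged -/

/-- **`s ↦ (d∕dt)^n xiShift (g₀ + tΞ) h (α₀ + us) (β₀ + vs) |₀` IS HOLOMORPHIC** on every open `U ⊆ {0 < re(β₀ + vs)}` — ★ (7d)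
`differentiableOn_iteratedDeriv_xiShift_param` with ★ (7b)'s radius and certificate chosen internally (user-facing form). -/
theorem differentiableOn_iteratedDeriv_xiShift_param' {d : ℝ × ℂ × ℝ} (hd : 0 < d.1 ∧ normSq d.2.1 < d.1 * d.2.2) (Ξ : Matrix (Fin 2) (Fin 2) ℂ)
    {h : Matrix (Fin 2) (Fin 2) ℂ} (hh : h.PosDef) (α₀ β₀ u v : ℂ) {U : Set ℂ} (hU : IsOpen U) (hU0 : ∀ s ∈ U, 0 < (β₀ + v * s).re)
    (n : ℕ) :
    DifferentiableOn ℂ (fun s : ℂ => iteratedDeriv n (fun t : ℂ => xiShift (hermTwo d + t • Ξ) h (α₀ + u * s) (β₀ + v * s)) 0) U := by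
  obtain ⟨r, K, hr, -, hcert, hdiffT⟩ := exists_differentiableOn_xiShift_param hd Ξ
  exact differentiableOn_iteratedDeriv_xiShift_param hd Ξ hr (fun t ht c hc => (hcert t ht c hc).1) hdiffT hh α₀ β₀ u v hU hU0 n

end Summit.HodgeConjecture.HodgeConjecture.Cruxes.HLiu418.K2LiuHermTwoXiShiftParamGrowthUniform

end
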